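import Mathlib
import Literature.AlgebraicGeometry.Resolution.WeightedInitialTerms
import HarnessLib

/-!
# The characteristic polygon of an idealistic exponent `(J, μ)`: integer invariants

Topic: `Literature/AlgebraicGeometry/Resolution`. Hironaka's invariants of the characteristic
polygon `Δ(J; u₁, u₂; y) ⊂ ℝ²_{≥0}` of an ideal `J` with assigned order `μ` in a regular local
ring of dimension `3` with regular system of parameters `c = (y, u₁, u₂)`
(Cossart–Jannsen–Saito, LNM 2270, Definition 11.1: `α, β, δ, γ⁺, γ⁻, ε, ζ` and the vertices
`v = (α, β)`, `w± = (δ − γ±, γ±)`; Cossart–Piltant 2008, §4 (14): `(α, β)` = the vertex of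
smallest abscissa), in the expansion-free form of `WeightedInitialTerms.lean`: the polygon is
the upper convex hull of the points `pt(e) = (e₁, e₂)/(μ − e₀)` for the Newton points
`e ∈ occ c J` with `e₀ < μ` (`pts c J μ`). We scale by `L = μ!` so that all points and all
invariants are NATURAL NUMBERS (`spt₁ e = e₁ · L/(μ − e₀)`, …): the descent arguments of CJS
Ch. 13–14 (`β ∈ (1/n!)ℤ`, (11.4)) become descents in `ℕ`.

PROVED:
* `levelWeight μ w₀ p₁ p₂ = (w₀, L p₁, L p₂)` and the **bridge**
  `le_weightedIdealW_levelWeight_iff`: `J ⊆ F^{(w₀, Lp₁, Lp₂)}_{w₀ μ} ⟺ ∀ e ∈ pts, p₁ spt₁ e +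
  p₂ spt₂ e ≥ w₀` — the half-planes containing the polygon are exactly the weighted order
  ideals containing `J` (positive `p₁, p₂`; from ★ of `WeightedInitialTerms`);
* the invariants `deltaS, alphaS, betaS, epsS, zetaS, gammaMinusS, gammaPlusS` (scaled by `L`),
  their attainment by Newton points, and the inequalities
  `ε ≤ γ⁻ ≤ γ⁺ ≤ β`, `α + γ⁺ ≤ δ ≤ α + β`, `ζ + ε ≥ δ` (CJS (11.1) and the picture below
  Definition 11.1);
* **realization weights** (`isInitialTerm_levelWeight_of_isMinOn`, `isMinOn_lex`): a Newton
  point minimising a positive linear form `p₁ spt₁ + p₂ spt₂` (resp. lexicographically two such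
  forms) over `pts` is an initial unit term of its element for the corresponding single weight —
  used to transport the vertices `v, w±, (ζ, ε)` through blow-up charts.

## Sources

* V. Cossart, U. Jannsen, S. Saito, LNM 2270 (2020), Def. 11.1, (11.1), Lemma 8.6, (11.4).
  [CossartJannsenSaito2020]
* V. Cossart, O. Piltant, J. Algebra 320 (2008), §4, (13)–(15), (18). [CossartPiltant2008]
* H. Hironaka, J. Math. Kyoto Univ. 7 (1967). [Hironaka1967]
-/

noncomputable section

open IsLocalRing MvPolynomial

namespace Literature.AlgebraicGeometry.Resolution

universe u

variable {R : Type u} [CommRing R]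

/-! ## Scaled points -/

/-- The scale factor `L/(μ − e₀)`, `L = μ!`, of an exponent with `e₀ < μ`. [cite: CossartJannsenSaito2020, Lemma 8.6] -/
def sfac (μ : ℕ) (e : Fin 3 →₀ ℕ) : ℕ := μ.factorial / (μ - e 0)

/-- `(μ − e₀) · L/(μ − e₀) = L`. [folklore] -/
theorem sub_mul_sfac {μ : ℕ} {e : Fin 3 →₀ ℕ} (he : e 0 < μ) :
    (μ - e 0) * sfac μ e = μ.factorial := by
  rw [sfac, mul_comm]
  exact Nat.div_mul_cancel (Nat.dvd_factorial (by omega) (by omega))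

/-- The scale factor is positive. [folklore] -/
theorem sfac_pos {μ : ℕ} {e : Fin 3 →₀ ℕ} (he : e 0 < μ) : 0 < sfac μ e := by
  have h := sub_mul_sfac he
  rcases Nat.eq_zero_or_pos (sfac μ e) with h0 | h0
  · rw [h0, mul_zero] at h; exact absurd h.symm (Nat.factorial_pos μ).ne'
  · exact h0

/-- First scaled coordinate `e₁ · L/(μ − e₀)` (`= L ·` abscissa of the point `pt(e)`).
[cite: CossartPiltant2008, §4 p. 10] -/
def spt₁ (μ : ℕ) (e : Fin 3 →₀ ℕ) : ℕ := e 1 * sfac μ e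

/-- Second scaled coordinate `e₂ · L/(μ − e₀)`. [cite: CossartPiltant2008, §4 p. 10] -/
def spt₂ (μ : ℕ) (e : Fin 3 →₀ ℕ) : ℕ := e 2 * sfac μ e

/-- The Newton points of `J` of `y`-degree `< μ` — those defining the polygon of `(J, μ)`.
[cite: CossartPiltant2008, §4 p. 10] [cite: CossartJannsenSaito2020, Def. 8.2 (1)] -/
def pts (c : Fin 3 → R) (J : Ideal R) (μ : ℕ) : Set (Fin 3 →₀ ℕ) := {e | e ∈ occ c J ∧ e 0 < μ}

/-- `pts` is monotone in `J`. [folklore] -/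
theorem pts_mono (c : Fin 3 → R) {J J' : Ideal R} (h : J ≤ J') (μ : ℕ) :
    pts c J μ ⊆ pts c J' μ := fun _ ⟨he, hlt⟩ => ⟨occ_mono c h he, hlt⟩

/-! ## Level weights and the bridge to the weighted order ideals -/

/-- The weight `(w₀, L p₁, L p₂)`: `⟨·, e⟩ ≥ w₀ μ` is the half-plane `p₁ x₁ + p₂ x₂ ≥ w₀` in scaled
coordinates. [cite: CossartJannsenSaito2020, Remark 8.9 (2)] -/
def levelWeight (μ w₀ p₁ p₂ : ℕ) : Fin 3 → ℕ := ![w₀, μ.factorial * p₁, μ.factorial * p₂]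

/-- Component / bookkeeping lemma. [folklore] -/
@[simp] theorem levelWeight_zero (μ w₀ p₁ p₂ : ℕ) : levelWeight μ w₀ p₁ p₂ 0 = w₀ := rfl
/-- Component / bookkeeping lemma. [folklore] -/
@[simp] theorem levelWeight_one (μ w₀ p₁ p₂ : ℕ) : levelWeight μ w₀ p₁ p₂ 1 = μ.factorial * p₁ := rfl
/-- Component / bookkeeping lemma. [folklore] -/
@[simp] theorem levelWeight_two (μ w₀ p₁ p₂ : ℕ) : levelWeight μ w₀ p₁ p₂ 2 = μ.factorial * p₂ := rfl

/-- Level weights with positive entries are positive. [folklore] -/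
theorem levelWeight_pos {μ w₀ p₁ p₂ : ℕ} (hw₀ : 0 < w₀) (hp₁ : 0 < p₁) (hp₂ : 0 < p₂) :
    ∀ i, 0 < levelWeight μ w₀ p₁ p₂ i := by
  intro i
  fin_cases i
  · exact hw₀
  · exact Nat.mul_pos (Nat.factorial_pos μ) hp₁
  · exact Nat.mul_pos (Nat.factorial_pos μ) hp₂

/-- The weight of `e` for a level weight. [folklore] -/
theorem weight_levelWeight (μ w₀ p₁ p₂ : ℕ) (e : Fin 3 →₀ ℕ) :
    Finsupp.weight (levelWeight μ w₀ p₁ p₂) e = w₀ * e 0 + μ.factorial * (p₁ * e 1 + p₂ * e 2) := by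
  rw [Finsupp.weight_apply, Finsupp.sum_fintype _ _ (by simp)]
  simp only [Fin.sum_univ_three, levelWeight_zero, levelWeight_one, levelWeight_two, smul_eq_mul]
  ring

/-- For `e₀ < μ`: `L (p₁ e₁ + p₂ e₂) = (μ − e₀)(p₁ spt₁ e + p₂ spt₂ e)`. [folklore] -/
theorem factorial_mul_eq_sub_mul {μ : ℕ} {e : Fin 3 →₀ ℕ} (he : e 0 < μ) (p₁ p₂ : ℕ) :
    μ.factorial * (p₁ * e 1 + p₂ * e 2) = (μ - e 0) * (p₁ * spt₁ μ e + p₂ * spt₂ μ e) := by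
  rw [← sub_mul_sfac he, spt₁, spt₂]; ring

/-- **Half-plane ⟷ weight inequality** for a Newton point of `y`-degree `< μ`.
[cite: CossartJannsenSaito2020, Remark 8.9 (2)] -/
theorem le_weight_levelWeight_iff {μ : ℕ} {e : Fin 3 →₀ ℕ} (he : e 0 < μ) (w₀ p₁ p₂ : ℕ) :
    w₀ * μ ≤ Finsupp.weight (levelWeight μ w₀ p₁ p₂) e ↔ w₀ ≤ p₁ * spt₁ μ e + p₂ * spt₂ μ e := by
  rw [weight_levelWeight, factorial_mul_eq_sub_mul he]
  set ℓ := p₁ * spt₁ μ e + p₂ * spt₂ μ e with hℓ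
  obtain ⟨d, hd, hμ⟩ : ∃ d, 0 < d ∧ μ = e 0 + d := ⟨μ - e 0, by omega, by omega⟩
  have hsub : μ - e 0 = d := by omega
  rw [hsub, hμ, Nat.mul_add]
  constructor
  · intro h
    have h' : d * w₀ ≤ d * ℓ := by rw [mul_comm d w₀]; omega
    exact Nat.le_of_mul_le_mul_left h' hd
  · intro h
    have h' : w₀ * d ≤ d * ℓ := by rw [mul_comm]; exact Nat.mul_le_mul_left _ h
    omega

/-- Exponents of `y`-degree `≥ μ` satisfy every level inequality. [folklore] -/
theorem le_weight_levelWeight_of_le {μ : ℕ} {e : Fin 3 →₀ ℕ} (he : μ ≤ e 0) (w₀ p₁ p₂ : ℕ) :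
    w₀ * μ ≤ Finsupp.weight (levelWeight μ w₀ p₁ p₂) e := by
  rw [weight_levelWeight]
  calc w₀ * μ ≤ w₀ * e 0 := Nat.mul_le_mul_left _ he
    _ ≤ _ := Nat.le_add_right _ _

section Regular

variable [IsRegularLocalRing R] (c : Fin 3 → R)
  (hgen : Ideal.span {c 0, c 1, c 2} = maximalIdeal R) (hdim : ringKrullDim R = 3)

include hgen hdim in
/-- **Bridge**: for positive `w₀, p₁, p₂`, `J ⊆ F^{(w₀, Lp₁, Lp₂)}_{w₀ μ} ⟺` every point of
`pts c J μ` lies in the half-plane `p₁ x₁ + p₂ x₂ ≥ w₀` (scaled).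
[cite: CossartJannsenSaito2020, Remark 8.9 (2)] [cite: CossartPiltant2008, §4 p. 10] -/
theorem le_weightedIdealW_levelWeight_iff (J : Ideal R) {μ w₀ p₁ p₂ : ℕ} (hw₀ : 0 < w₀)
    (hp₁ : 0 < p₁) (hp₂ : 0 < p₂) :
    J ≤ weightedIdealW c (levelWeight μ w₀ p₁ p₂) (w₀ * μ) ↔
      ∀ e ∈ pts c J μ, w₀ ≤ p₁ * spt₁ μ e + p₂ * spt₂ μ e := by
  rw [le_weightedIdealW_iff_forall_occ c hgen hdim (levelWeight_pos hw₀ hp₁ hp₂) J]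
  constructor
  · rintro h e ⟨he, hlt⟩
    exact (le_weight_levelWeight_iff hlt w₀ p₁ p₂).mp (h e he)
  · intro h e he
    by_cases hlt : e 0 < μ
    · exact (le_weight_levelWeight_iff hlt w₀ p₁ p₂).mpr (h e ⟨he, hlt⟩)
    · exact le_weight_levelWeight_of_le (not_lt.mp hlt) w₀ p₁ p₂

include hgen hdim in
/-- If `J ⊆ 𝔪^μ` then every point of `pts` satisfies `spt₁ + spt₂ ≥ L` ("`δ ≥ 1`",
CJS Lemma 8.4 (1)). [cite: CossartJannsenSaito2020, Lemma 8.4 (1)] -/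
theorem factorial_le_spt_add {J : Ideal R} {μ : ℕ} (hJ : J ≤ maximalIdeal R ^ μ)
    {e : Fin 3 →₀ ℕ} (he : e ∈ pts c J μ) : μ.factorial ≤ spt₁ μ e + spt₂ μ e := by
  obtain ⟨he, hlt⟩ := he
  have hdeg := le_degree_of_mem_occ c hgen hdim hJ he
  rw [Finsupp.degree_eq_sum, Fin.sum_univ_three] at hdeg
  rw [spt₁, spt₂, ← add_mul, ← sub_mul_sfac hlt]
  exact Nat.mul_le_mul_right _ (by omega)

end Regular

/-! ## The invariants (scaled by `L = μ!`) -/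

section Invariants

variable (c : Fin 3 → R) (J : Ideal R) (μ : ℕ)

/-- `L · δ(J; u; y) = min {spt₁ e + spt₂ e}`. [cite: CossartJannsenSaito2020, Def. 11.1] -/
def deltaS : ℕ := sInf ((fun e => spt₁ μ e + spt₂ μ e) '' pts c J μ)

/-- `L · α = min spt₁`. [cite: CossartJannsenSaito2020, Def. 11.1] [cite: CossartPiltant2008, §4 (14)] -/
def alphaS : ℕ := sInf (spt₁ μ '' pts c J μ)

/-- `L · β = min {spt₂ e : spt₁ e = L α}` (the ordinate of the vertex `v` of smallest abscissa).
[cite: CossartJannsenSaito2020, Def. 11.1] [cite: CossartPiltant2008, §4 (14)] -/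
def betaS : ℕ := sInf (spt₂ μ '' {e | e ∈ pts c J μ ∧ spt₁ μ e = alphaS c J μ})

/-- `L · ε = min spt₂`. [cite: CossartJannsenSaito2020, Def. 11.1] -/
def epsS : ℕ := sInf (spt₂ μ '' pts c J μ)

/-- `L · ζ = min {spt₁ e : spt₂ e = L ε}`. [cite: CossartJannsenSaito2020, Def. 11.1] -/
def zetaS : ℕ := sInf (spt₁ μ '' {e | e ∈ pts c J μ ∧ spt₂ μ e = epsS c J μ})

/-- `L · γ⁻ = min {spt₂ e : e on the δ-line}`. [cite: CossartJannsenSaito2020, Def. 11.1] -/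
def gammaMinusS : ℕ := sInf (spt₂ μ '' {e | e ∈ pts c J μ ∧ spt₁ μ e + spt₂ μ e = deltaS c J μ})

/-- `L · γ⁺ = max {spt₂ e : e on the δ-line}`. [cite: CossartJannsenSaito2020, Def. 11.1] -/
def gammaPlusS : ℕ := sSup (spt₂ μ '' {e | e ∈ pts c J μ ∧ spt₁ μ e + spt₂ μ e = deltaS c J μ})

variable {c J μ}

/-- `δ` is attained. [folklore] -/
theorem exists_pts_deltaS (hne : (pts c J μ).Nonempty) :
    ∃ e ∈ pts c J μ, spt₁ μ e + spt₂ μ e = deltaS c J μ := by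
  have := Nat.sInf_mem (hne.image (fun e => spt₁ μ e + spt₂ μ e))
  obtain ⟨e, he, h⟩ := (Set.mem_image _ _ _).mp this
  exact ⟨e, he, h⟩

/-- `δ` is a lower bound. [folklore] -/
theorem deltaS_le {e : Fin 3 →₀ ℕ} (he : e ∈ pts c J μ) : deltaS c J μ ≤ spt₁ μ e + spt₂ μ e :=
  Nat.sInf_le ⟨e, he, rfl⟩

/-- `α` is attained. [folklore] -/
theorem exists_pts_alphaS (hne : (pts c J μ).Nonempty) :
    ∃ e ∈ pts c J μ, spt₁ μ e = alphaS c J μ := by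
  have := Nat.sInf_mem (hne.image (spt₁ μ))
  obtain ⟨e, he, h⟩ := (Set.mem_image _ _ _).mp this
  exact ⟨e, he, h⟩

/-- `α` is a lower bound. [folklore] -/
theorem alphaS_le {e : Fin 3 →₀ ℕ} (he : e ∈ pts c J μ) : alphaS c J μ ≤ spt₁ μ e :=
  Nat.sInf_le ⟨e, he, rfl⟩

/-- The vertex `v = (α, β)` is attained. [cite: CossartJannsenSaito2020, Def. 11.1] -/
theorem exists_pts_v (hne : (pts c J μ).Nonempty) :
    ∃ e ∈ pts c J μ, spt₁ μ e = alphaS c J μ ∧ spt₂ μ e = betaS c J μ := by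
  obtain ⟨e₀, he₀, h₀⟩ := exists_pts_alphaS hne
  have hne' : ({e | e ∈ pts c J μ ∧ spt₁ μ e = alphaS c J μ}).Nonempty := ⟨e₀, he₀, h₀⟩
  have := Nat.sInf_mem (hne'.image (spt₂ μ))
  obtain ⟨e, ⟨he, h1⟩, h2⟩ := (Set.mem_image _ _ _).mp this
  exact ⟨e, he, h1, h2⟩

/-- `β` is a lower bound on the line `spt₁ = α`. [folklore] -/
theorem betaS_le {e : Fin 3 →₀ ℕ} (he : e ∈ pts c J μ) (h1 : spt₁ μ e = alphaS c J μ) :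
    betaS c J μ ≤ spt₂ μ e :=
  Nat.sInf_le ⟨e, ⟨he, h1⟩, rfl⟩

/-- `ε` is attained. [folklore] -/
theorem exists_pts_epsS (hne : (pts c J μ).Nonempty) :
    ∃ e ∈ pts c J μ, spt₂ μ e = epsS c J μ := by
  have := Nat.sInf_mem (hne.image (spt₂ μ))
  obtain ⟨e, he, h⟩ := (Set.mem_image _ _ _).mp this
  exact ⟨e, he, h⟩

/-- `ε` is a lower bound. [folklore] -/
theorem epsS_le {e : Fin 3 →₀ ℕ} (he : e ∈ pts c J μ) : epsS c J μ ≤ spt₂ μ e :=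
  Nat.sInf_le ⟨e, he, rfl⟩

/-- The lowest vertex `(ζ, ε)` is attained. [cite: CossartJannsenSaito2020, Def. 11.1] -/
theorem exists_pts_zeta (hne : (pts c J μ).Nonempty) :
    ∃ e ∈ pts c J μ, spt₂ μ e = epsS c J μ ∧ spt₁ μ e = zetaS c J μ := by
  obtain ⟨e₀, he₀, h₀⟩ := exists_pts_epsS hne
  have hne' : ({e | e ∈ pts c J μ ∧ spt₂ μ e = epsS c J μ}).Nonempty := ⟨e₀, he₀, h₀⟩
  have := Nat.sInf_mem (hne'.image (spt₁ μ))
  obtain ⟨e, ⟨he, h1⟩, h2⟩ := (Set.mem_image _ _ _).mp this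
  exact ⟨e, he, h1, h2⟩

/-- `ζ` is a lower bound on the line `spt₂ = ε`. [folklore] -/
theorem zetaS_le {e : Fin 3 →₀ ℕ} (he : e ∈ pts c J μ) (h2 : spt₂ μ e = epsS c J μ) :
    zetaS c J μ ≤ spt₁ μ e :=
  Nat.sInf_le ⟨e, ⟨he, h2⟩, rfl⟩

/-- The vertex `w⁻ = (δ − γ⁻, γ⁻)` is attained. [cite: CossartJannsenSaito2020, Def. 11.1] -/
theorem exists_pts_wMinus (hne : (pts c J μ).Nonempty) :
    ∃ e ∈ pts c J μ, spt₁ μ e + spt₂ μ e = deltaS c J μ ∧ spt₂ μ e = gammaMinusS c J μ := by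
  obtain ⟨e₀, he₀, h₀⟩ := exists_pts_deltaS hne
  have hne' : ({e | e ∈ pts c J μ ∧ spt₁ μ e + spt₂ μ e = deltaS c J μ}).Nonempty :=
    ⟨e₀, he₀, h₀⟩
  have := Nat.sInf_mem (hne'.image (spt₂ μ))
  obtain ⟨e, ⟨he, h1⟩, h2⟩ := (Set.mem_image _ _ _).mp this
  exact ⟨e, he, h1, h2⟩

/-- `γ⁻` is a lower bound on the `δ`-line. [folklore] -/
theorem gammaMinusS_le {e : Fin 3 →₀ ℕ} (he : e ∈ pts c J μ)
    (h : spt₁ μ e + spt₂ μ e = deltaS c J μ) : gammaMinusS c J μ ≤ spt₂ μ e :=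
  Nat.sInf_le ⟨e, ⟨he, h⟩, rfl⟩

/-- The ordinates on the `δ`-line are bounded by `δ`. [folklore] -/
theorem bddAbove_deltaLine :
    BddAbove (spt₂ μ '' {e | e ∈ pts c J μ ∧ spt₁ μ e + spt₂ μ e = deltaS c J μ}) := by
  refine ⟨deltaS c J μ, ?_⟩
  rintro _ ⟨e, ⟨-, h⟩, rfl⟩
  omega

/-- The vertex `w⁺ = (δ − γ⁺, γ⁺)` is attained. [cite: CossartJannsenSaito2020, Def. 11.1] -/
theorem exists_pts_wPlus (hne : (pts c J μ).Nonempty) :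
    ∃ e ∈ pts c J μ, spt₁ μ e + spt₂ μ e = deltaS c J μ ∧ spt₂ μ e = gammaPlusS c J μ := by
  obtain ⟨e₀, he₀, h₀⟩ := exists_pts_deltaS hne
  have hne' : ({e | e ∈ pts c J μ ∧ spt₁ μ e + spt₂ μ e = deltaS c J μ}).Nonempty :=
    ⟨e₀, he₀, h₀⟩
  have := Nat.sSup_mem (hne'.image (spt₂ μ)) bddAbove_deltaLine
  obtain ⟨e, ⟨he, h1⟩, h2⟩ := (Set.mem_image _ _ _).mp this
  exact ⟨e, he, h1, h2⟩

/-- `γ⁺` is an upper bound on the `δ`-line. [folklore] -/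
theorem le_gammaPlusS {e : Fin 3 →₀ ℕ} (he : e ∈ pts c J μ)
    (h : spt₁ μ e + spt₂ μ e = deltaS c J μ) : spt₂ μ e ≤ gammaPlusS c J μ :=
  le_csSup bddAbove_deltaLine ⟨e, ⟨he, h⟩, rfl⟩

/-! ### Inequalities (CJS (11.1) and the picture below Definition 11.1) -/

/-- `δ ≤ α + β` (the vertex `v` lies in the polygon). [cite: CossartJannsenSaito2020, (11.1)] -/
theorem deltaS_le_alphaS_add_betaS (hne : (pts c J μ).Nonempty) :
    deltaS c J μ ≤ alphaS c J μ + betaS c J μ := by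
  obtain ⟨e, he, h1, h2⟩ := exists_pts_v hne
  rw [← h1, ← h2]; exact deltaS_le he

/-- `γ⁻ ≤ γ⁺`. [cite: CossartJannsenSaito2020, (11.1)] -/
theorem gammaMinusS_le_gammaPlusS (hne : (pts c J μ).Nonempty) :
    gammaMinusS c J μ ≤ gammaPlusS c J μ := by
  obtain ⟨e, he, h1, h2⟩ := exists_pts_wPlus hne
  rw [← h2]; exact gammaMinusS_le he h1

/-- `ε ≤ γ⁻`. [cite: CossartJannsenSaito2020, Def. 11.1] -/
theorem epsS_le_gammaMinusS (hne : (pts c J μ).Nonempty) :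
    epsS c J μ ≤ gammaMinusS c J μ := by
  obtain ⟨e, he, -, h2⟩ := exists_pts_wMinus hne
  rw [← h2]; exact epsS_le he

/-- `α + γ⁺ ≤ δ` (the abscissa of `w⁺` is at least `α`). [cite: CossartJannsenSaito2020, (11.1)] -/
theorem alphaS_add_gammaPlusS_le_deltaS (hne : (pts c J μ).Nonempty) :
    alphaS c J μ + gammaPlusS c J μ ≤ deltaS c J μ := by
  obtain ⟨e, he, h1, h2⟩ := exists_pts_wPlus hne
  have := alphaS_le he
  omega

/-- `γ⁺ ≤ β` (CJS (11.1): `β ≥ γ⁺ ≥ γ⁻`). [cite: CossartJannsenSaito2020, (11.1)] -/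
theorem gammaPlusS_le_betaS (hne : (pts c J μ).Nonempty) :
    gammaPlusS c J μ ≤ betaS c J μ := by
  have h1 := deltaS_le_alphaS_add_betaS hne
  have h2 := alphaS_add_gammaPlusS_le_deltaS hne
  omega

/-- `δ ≤ ζ + ε` (the lowest vertex lies in the polygon). [cite: CossartJannsenSaito2020, Def. 11.1] -/
theorem deltaS_le_zetaS_add_epsS (hne : (pts c J μ).Nonempty) :
    deltaS c J μ ≤ zetaS c J μ + epsS c J μ := by
  obtain ⟨e, he, h2, h1⟩ := exists_pts_zeta hne
  rw [← h1, ← h2]; exact deltaS_le he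

/-- `α ≤ ζ`. [cite: CossartJannsenSaito2020, Def. 11.1] -/
theorem alphaS_le_zetaS (hne : (pts c J μ).Nonempty) : alphaS c J μ ≤ zetaS c J μ := by
  obtain ⟨e, he, -, h1⟩ := exists_pts_zeta hne
  rw [← h1]; exact alphaS_le he

/-- `ε ≤ β`. [cite: CossartJannsenSaito2020, Def. 11.1] -/
theorem epsS_le_betaS (hne : (pts c J μ).Nonempty) : epsS c J μ ≤ betaS c J μ := by
  obtain ⟨e, he, -, h2⟩ := exists_pts_v hne
  rw [← h2]; exact epsS_le he

end Invariants

/-! ## Realization weights: minimisers are single-weight initial terms -/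

/-- **Lexicographic minima are minima of one combined form**: if `e⋆` minimises `ℓ₁` over `S`
and `ℓ₂` over the minimisers of `ℓ₁`, then `e⋆` minimises `N ℓ₁ + ℓ₂` over `S` for
`N = ℓ₂ e⋆ + 1` (integer-valued forms). [folklore] -/
theorem isMinOn_lex {α : Type*} {S : Set α} {ℓ₁ ℓ₂ : α → ℕ} {e : α}
    (h₁ : ∀ x ∈ S, ℓ₁ e ≤ ℓ₁ x) (h₂ : ∀ x ∈ S, ℓ₁ x = ℓ₁ e → ℓ₂ e ≤ ℓ₂ x) :
    ∀ x ∈ S, (ℓ₂ e + 1) * ℓ₁ e + ℓ₂ e ≤ (ℓ₂ e + 1) * ℓ₁ x + ℓ₂ x := by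
  intro x hx
  rcases (h₁ x hx).eq_or_lt with h | h
  · have := h₂ x hx h.symm; rw [← h]; omega
  · have h' : ℓ₁ e + 1 ≤ ℓ₁ x := h
    have := Nat.mul_le_mul_left (ℓ₂ e + 1) h'
    rw [Nat.mul_add, mul_one] at this
    omega

section Realization

variable [IsRegularLocalRing R] (c : Fin 3 → R)
  (hgen : Ideal.span {c 0, c 1, c 2} = maximalIdeal R) (hdim : ringKrullDim R = 3)

/-- The level weight attached to a minimiser `e⋆` of `ℓ = p₁ spt₁ + p₂ spt₂` takes the value
`ℓ(e⋆) μ` at `e⋆`. [folklore] -/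
theorem weight_levelWeight_self {μ : ℕ} {e : Fin 3 →₀ ℕ} (he : e 0 < μ) (p₁ p₂ : ℕ) :
    Finsupp.weight (levelWeight μ (p₁ * spt₁ μ e + p₂ * spt₂ μ e) p₁ p₂) e =
      (p₁ * spt₁ μ e + p₂ * spt₂ μ e) * μ := by
  rw [weight_levelWeight, factorial_mul_eq_sub_mul he]
  set ℓ := p₁ * spt₁ μ e + p₂ * spt₂ μ e with hℓ
  obtain ⟨d, hμ⟩ : ∃ d, μ = e 0 + d := ⟨μ - e 0, by omega⟩
  have hsub : μ - e 0 = d := by omega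
  rw [hsub, hμ]; ring

include hgen hdim in
/-- **Realization weight of a minimiser**: if `e⋆ ∈ pts c J μ` minimises the positive form
`ℓ = p₁ spt₁ + p₂ spt₂` over `pts c J μ` and `ℓ(e⋆) > 0`, then `J ⊆ F^{(ℓ(e⋆), Lp₁, Lp₂)}_{ℓ(e⋆) μ}`
and every element of `J` having `e⋆` as an initial unit term (for any positive weight) has `e⋆`
as an initial unit term for the level weight `(ℓ(e⋆), Lp₁, Lp₂)`.
[cite: CossartJannsenSaito2020, Lemma 8.3 (4)] -/
theorem isInitialTerm_levelWeight_of_isMinOn {J : Ideal R} {μ p₁ p₂ : ℕ} (hp₁ : 0 < p₁)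
    (hp₂ : 0 < p₂) {e : Fin 3 →₀ ℕ} (he : e ∈ pts c J μ)
    (hmin : ∀ x ∈ pts c J μ, p₁ * spt₁ μ e + p₂ * spt₂ μ e ≤ p₁ * spt₁ μ x + p₂ * spt₂ μ x)
    (hpos : 0 < p₁ * spt₁ μ e + p₂ * spt₂ μ e) {f : R} (hf : f ∈ J) {w : Fin 3 → ℕ}
    (hw : ∀ i, 0 < w i) (hinit : IsInitialTerm c w f e) :
    IsInitialTerm c (levelWeight μ (p₁ * spt₁ μ e + p₂ * spt₂ μ e) p₁ p₂) f e := by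
  set ℓ := p₁ * spt₁ μ e + p₂ * spt₂ μ e with hℓ
  set w' := levelWeight μ ℓ p₁ p₂ with hw'def
  have hw' : ∀ i, 0 < w' i := levelWeight_pos hpos hp₁ hp₂
  have hJ : J ≤ weightedIdealW c w' (ℓ * μ) :=
    (le_weightedIdealW_levelWeight_iff c hgen hdim J hpos hp₁ hp₂).mpr hmin
  have hgenr := span_range_eq_of_span_triple c hgen
  set N := max (Finsupp.weight w e + 1) (Finsupp.weight w' e + 1) with hN
  obtain ⟨F, hFu, -, hFrem⟩ := exists_unitRep c hgenr f N
  have hremw : f - eval c F ∈ weightedIdealW c w N :=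
    pow_maximalIdeal_le_weightedIdealW c hgenr hw N hFrem
  have hremw' : f - eval c F ∈ weightedIdealW c w' N :=
    pow_maximalIdeal_le_weightedIdealW c hgenr hw' N hFrem
  have heF : e ∈ F.support :=
    ((isInitialTerm_iff_of_unitRep c hgen hdim hw hFu hremw (by omega)).mp hinit).1
  refine (isInitialTerm_iff_of_unitRep c hgen hdim hw' hFu hremw' (by omega)).mpr ⟨heF, ?_⟩
  have hwe : Finsupp.weight w' e = ℓ * μ := weight_levelWeight_self he.2 p₁ p₂
  have hle : ℓ * μ ≤ N := by omega
  have hall := (mem_weightedIdealW_iff_of_unitRep c hgen hdim hw' hFu hremw' hle).mp (hJ hf)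
  intro m hm
  rw [hwe]; exact hall m hm

include hgen hdim in
/-- Every point of `pts` is an initial unit term of some element of `J` for the level weight of
any positive form it minimises. [cite: CossartJannsenSaito2020, Lemma 8.3 (4)] -/
theorem exists_isInitialTerm_levelWeight_of_isMinOn {J : Ideal R} {μ p₁ p₂ : ℕ} (hp₁ : 0 < p₁)
    (hp₂ : 0 < p₂) {e : Fin 3 →₀ ℕ} (he : e ∈ pts c J μ)
    (hmin : ∀ x ∈ pts c J μ, p₁ * spt₁ μ e + p₂ * spt₂ μ e ≤ p₁ * spt₁ μ x + p₂ * spt₂ μ x)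
    (hpos : 0 < p₁ * spt₁ μ e + p₂ * spt₂ μ e) :
    ∃ f ∈ J, IsInitialTerm c (levelWeight μ (p₁ * spt₁ μ e + p₂ * spt₂ μ e) p₁ p₂) f e := by
  have he' := he
  obtain ⟨⟨f, hf, w, hw, hinit⟩, -⟩ := he'
  exact ⟨f, hf, isInitialTerm_levelWeight_of_isMinOn c hgen hdim hp₁ hp₂ he hmin hpos hf hw hinit⟩

end Realization

end Literature.AlgebraicGeometry.Resolution
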